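import Literature.AnabelianGeometry.EtaleTheta.FrobenioidThetaDivisorSupportAdjacencyCount

/-!
# [EtTh] §5, Proposition 5.3 (v): the "4 versus 5 or 6" adjacency criterion FROM the intersection theory of the chain (GAP-LEDGER G-L2d4-2, part 3)

Mochizuki, *The étale theta function …*, Publ. RIMS **45** (2009)
[cite: MochizukiEtTh2009, Prop 5.3 proof p.326–327 (PDF pp.100–101); §1 p.240 (PDF p.14)].
Seat abc-iut-L6-d1 (gen 3); proof-only assembly over `FrobenioidThetaDivisorSupportAdjacencyCount.lean`.

WHAT IS PROVED: `adjacencyCriterion'_of_principalIffDegreeZero` — under the structural hypothesis binder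
`DivisorSupportData'.PrincipalIffDegreeZero 𝔖` ([EtTh] §1 p.240: "these degrees determine an isomorphism
`Pic(𝔜_N) ⥲ ℤ^ℤ`"), the verbatim p.326–327 criterion `AdjacencyCriterion' 𝔖` holds: "if `a ∈ 𝔭`, `b ∈ 𝔮`
correspond via the natural isomorphisms of (ii), then `𝔭, 𝔮` are adjacent (respectively, not adjacent) if and only
if every cuspidally minimal `c ∈ Φ(A_⊚)^gp` which is linearly equivalent to `a + b` has support of cardinality `4`
(respectively, `5` or `6`). [Here, the numbers '4', '5', '6' correspond to the number of non-cuspidal primes that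
are either contained in or adjacent to a prime contained in the support of `a + b`.]"  Route: `a = m·gen 𝔭` and
`b = m·gen 𝔮` (the component isomorphism maps `gen ↦ gen`, `submonoidEquiv_gen_pow`); the cuspidally minimal `c ∼ a + b`
are exactly the cuspidal `c ∼ a + b` of finite support with `#supp c = #{components of non-zero degree of a + b}`
(lower bound `ncard_le_of_cuspidal_linEquiv`, attained by `exists_cuspidal_linEquiv_pair`), and that number is
`4` iff `|p − q| = 1`, `5` or `6` iff not (`FrobenioidThetaDivisorChainCount`).
With `cspToNcspCriterion'_of_degree` and `cspToNcspWitnessed'_of_principalIffDegreeZero`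
(`FrobenioidThetaDivisorSupportIntersection.lean`) this closes GAP-LEDGER row G-L2d4-2: all three verbatim criteria
of the printed proof of Prop. 5.3 (iv)(v) follow from the single structural hypothesis; abc-iut-L2-d4's
`Discharge/Sec5Prop53LabelsR.lean` turns them into Prop. 5.3 (iv), (v) themselves (modulo (i) and F1-Ψ).
NOTE FOR THE DISCHARGER of `PrincipalIffDegreeZero` (recorded, not used): the binder is the WEIGHT-ONE form
`Δ²(ord in gen-units) + Σ_cusps`.  Weight one is the right normalisation when `Φ(A_⊚)` is realised as the effective
CARTIER log-divisors on `𝔜̈_L` itself, `gen` of a component being its minimal Cartier multiple `ë·n_j` (`ë` = thickness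
of the nodes): then `deg 𝒪(gen n_j)|_{n_{j±1}} = 1`, `|_{n_j} = −2`, cusps `1`, and [EtTh] §1 p.240 gives both directions
(checked on `div(Θ̈)`, `div(Ü)` by abc-iut-w5-d203, 2026-08-26T04:46Z).  An instance realising `Φ(A_⊚)` through a
finer `Δ^fil`-closure `Z_∞ → Ÿ` ([EtTh] Def. 3.3 (iii)) may rescale the component coordinates and may contain elements
Cartier on `Z_∞` but only `ℚ`-Cartier on `𝔜̈_L` (e.g. `Σ_j j·n_j = div(Ü)/ë` for `ë > 1`), for which "degrees vanish ⇒
principal" fails; such an instance needs the binder restated (weight `λ`, Cartier-on-`𝔜̈` side condition) — the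
`λ`-parametric combinatorics of `ChainDivisorCombinatorics.lean` (abc-iut-w5-d203) is the tool; the three printed
criteria themselves are `λ`-robust ("half the multiplicity", p.326).
HONEST FRAMING: an implication between predicates on OUR typed data; `PrincipalIffDegreeZero` is to be discharged at
the genuine special fibre of `Ÿ` by its owner; no side taken on anything downstream; typed ≠ proved for the curve. -/

namespace Literature.AnabelianGeometry.EtaleTheta

open CategoryTheory
open Literature.AlgebraicGeometry.Frobenioids

universe w v v' u u'

namespace FrobenioidThetaDivisors

namespace DivisorSupportData'

open scoped Classical

variable {C : Type u} [Category.{v} C] {D : Type u'} [Category.{v'} D] {𝔉 : ThetaFrobenioid.{w} C D}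
variable {𝔓 : DivisorPrimeData 𝔉} (𝔖 : DivisorSupportData' 𝔓)

/-- Under `PrincipalIffDegreeZero`, for `V = m·(gen P + gen Q)` (`P ≠ Q`, `m ≥ 1`): the cuspidally minimal
elements linearly equivalent to `V` all have support of cardinality `#{components of non-zero V-degree}`, and
there is one.  [cite: MochizukiEtTh2009, Prop 5.3 proof p.326–327 (PDF pp.100–101)] -/
theorem ncard_supp_of_isCuspidallyMinimal_pair (hI : 𝔖.PrincipalIffDegreeZero)
    (P Q : {p : Primes 𝔉.PhiAcirc // ¬ 𝔓.IsCuspidal p}) (hPQ : P ≠ Q) (m : ℕ) (hm : 0 < m) :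
    (∀ c, 𝔖.IsCuspidallyMinimal c →
      𝔖.LinEquiv c (Algebra.GrothendieckGroup.of (𝔖.gen P.1) ^ m * Algebra.GrothendieckGroup.of (𝔖.gen Q.1) ^ m) →
      (𝔖.supp c).ncard = {𝔪 | 𝔖.degOn 𝔪 (Algebra.GrothendieckGroup.of (𝔖.gen P.1) ^ m *
        Algebra.GrothendieckGroup.of (𝔖.gen Q.1) ^ m) ≠ 0}.ncard) ∧
    (∃ c, 𝔖.IsCuspidallyMinimal c ∧
      𝔖.LinEquiv c (Algebra.GrothendieckGroup.of (𝔖.gen P.1) ^ m * Algebra.GrothendieckGroup.of (𝔖.gen Q.1) ^ m)) := by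
  obtain ⟨c₀, hc₀cusp, hc₀fin, hc₀lin, hc₀card⟩ := 𝔖.exists_cuspidal_linEquiv_pair hI P Q hPQ m hm
  set V := Algebra.GrothendieckGroup.of (𝔖.gen P.1) ^ m * Algebra.GrothendieckGroup.of (𝔖.gen Q.1) ^ m with hVdef
  have hVfin : (𝔖.supp V).Finite :=
    ((((𝔖.supp_gen_finite P.1).subset (𝔖.supp_pow_subset _ m))).union
      ((𝔖.supp_gen_finite Q.1).subset (𝔖.supp_pow_subset _ m))).subset (𝔖.supp_mul_subset _ _)
  have hP : ∀ x : Algebra.GrothendieckGroup 𝔉.PhiAcirc, 𝔖.IsPrincipal x → ∀ 𝔪, 𝔖.degOn 𝔪 x = 0 :=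
    fun x hx => (hI x).mp hx
  have hc₀min : 𝔖.IsCuspidallyMinimal c₀ := by
    refine ⟨hc₀cusp, hc₀fin, fun y hy hyfin hylin => ?_⟩
    change (𝔖.supp c₀).ncard ≤ (𝔖.supp y).ncard
    rw [hc₀card]
    have hyV : 𝔖.LinEquiv y V := by
      change y * V⁻¹ ∈ 𝔖.principal
      have h := 𝔖.principal.mul_mem hylin hc₀lin
      convert h using 1; group
    exact 𝔖.ncard_le_of_cuspidal_linEquiv hP hVfin hy hyfin hyV
  refine ⟨fun c hc hlin => le_antisymm ?_ ?_, c₀, hc₀min, hc₀lin⟩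
  · -- `≤`: minimality of `c` against the competitor `c₀ ∼ c`
    have hlin' : LinEquivOf 𝔖.principal c₀ c := by
      change c₀ * c⁻¹ ∈ 𝔖.principal
      have h := 𝔖.principal.mul_mem hc₀lin (𝔖.principal.inv_mem hlin)
      convert h using 1; group
    have h := hc.2.2 c₀ hc₀cusp hc₀fin hlin'
    change (𝔖.supp c).ncard ≤ (𝔖.supp c₀).ncard at h
    rwa [hc₀card] at h
  · -- `≥`: a cusp over every component of non-zero degree
    exact 𝔖.ncard_le_of_cuspidal_linEquiv hP hVfin hc.1 hc.2.1 hlin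

/-- **[EtTh] Prop. 5.3 (v), the "4 versus 5 or 6" criterion, from the intersection theory of the chain**:
`PrincipalIffDegreeZero 𝔖 → AdjacencyCriterion' 𝔖`.
[cite: MochizukiEtTh2009, Prop 5.3 proof p.326–327 (PDF pp.100–101); §1 p.240 (PDF p.14)] -/
theorem adjacencyCriterion'_of_principalIffDegreeZero (hI : 𝔖.PrincipalIffDegreeZero) :
    AdjacencyCriterion' 𝔖 := by
  intro 𝔭 𝔮 h𝔭 h𝔮 hne a ha
  -- `a = m·gen 𝔭`, and its correspondent `b = m·gen 𝔮`
  obtain ⟨m, hm, hagen⟩ := (𝔖.mem_carrier_iff 𝔭 _).mp ha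
  have hbgen : ((𝔓.ncspIso 𝔭 𝔮 h𝔭 h𝔮 a : 𝔮.submonoid) : 𝔉.PhiAcirc) = 𝔖.gen 𝔮 ^ m :=
    𝔖.submonoidEquiv_gen_pow 𝔭 𝔮 (𝔓.ncspIso 𝔭 𝔮 h𝔭 h𝔮) m a hagen
  have hPQ : (⟨𝔭, h𝔭⟩ : {p : Primes 𝔉.PhiAcirc // ¬ 𝔓.IsCuspidal p}) ≠ ⟨𝔮, h𝔮⟩ :=
    fun h => hne (congrArg Subtype.val h)
  have hpq : 𝔓.ncspEquivZ ⟨𝔭, h𝔭⟩ ≠ 𝔓.ncspEquivZ ⟨𝔮, h𝔮⟩ := fun h => hPQ (𝔓.ncspEquivZ.injective h)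
  obtain ⟨hall, c₀, hc₀min, hc₀lin⟩ := 𝔖.ncard_supp_of_isCuspidallyMinimal_pair hI ⟨𝔭, h𝔭⟩ ⟨𝔮, h𝔮⟩ hPQ m hm
  have hcount := 𝔖.ncard_setOf_degOn_pair_ne_zero ⟨𝔭, h𝔭⟩ ⟨𝔮, h𝔮⟩ m hPQ hm
  have hV : Algebra.GrothendieckGroup.of (a : 𝔉.PhiAcirc) *
      Algebra.GrothendieckGroup.of ((𝔓.ncspIso 𝔭 𝔮 h𝔭 h𝔮 a : 𝔮.submonoid) : 𝔉.PhiAcirc) =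
      Algebra.GrothendieckGroup.of (𝔖.gen 𝔭) ^ m * Algebra.GrothendieckGroup.of (𝔖.gen 𝔮) ^ m := by
    rw [hagen, hbgen, map_pow, map_pow]
  show (_ ↔ _) ∧ (_ ↔ _)
  rw [hV]
  constructor
  · -- adjacent ↔ every cuspidally minimal `c ∼ a + b` has `#supp c = 4`
    unfold Adjacent
    rw [← chainNbhd_card_eq_four_iff hpq, ← hcount]
    constructor
    · intro h4 c hc hlin; rw [hall c hc hlin]; exact h4
    · intro h; rw [← hall c₀ hc₀min hc₀lin]; exact h c₀ hc₀min hc₀lin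
  · -- not adjacent ↔ every cuspidally minimal `c ∼ a + b` has `#supp c = 5` or `6`
    unfold Adjacent
    rw [← ne_eq, ← chainNbhd_card_eq_five_or_six_iff hpq, ← hcount]
    constructor
    · intro h56 c hc hlin; rw [hall c hc hlin]; exact h56
    · intro h; rw [← hall c₀ hc₀min hc₀lin]; exact h c₀ hc₀min hc₀lin

end DivisorSupportData'

end FrobenioidThetaDivisors

end Literature.AnabelianGeometry.EtaleTheta
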